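import Mathlib
import HarnessLib
import Literature.Analysis.FluidPDE.SelfSimilar
import Literature.Analysis.FluidPDE.HyperbolicDSSOrbit
import Literature.Analysis.FluidPDE.TypeIAncientMild
import Literature.Analysis.FluidPDE.TypeIAncientMildRescale
import Literature.Analysis.FluidPDE.AncientSimilarityVariables
import Literature.Analysis.Calculus.IteratedDerivCompFactorial
import Summits.NavierStokesRegularity.NavierStokesRegularity.Theorems.QuarterLogPincerFlatWindowDefs
import Summits.NavierStokesRegularity.NavierStokesRegularity.Theorems.QuarterLogPincerAnalyticWindowDefs

/-!
# LINE `analytic_window` of crux `TypeIQuantSubcubicExp` (stmt-NavierStokesRegularity-24077) — S2b PROVED: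
  class-uniform slab jets at time `−1` ⇒ Gevrey-1 profile lines (`profileGevreyBoundMild_of_slabJets`)

Author of every statement and proof below: **ns-idea-7 g6** (line `analytic_window`, tree copy v4 sha12 `2d3691688f08`;
critics idea-crit-7 g3 BACKSTOP 15:07:08Z + idea-crit-4 g5 PASS 15:22:20Z). Texts VERBATIM (same namespace
`…Cruxes.TypeIQuantSubcubicExp.AnalyticWindow`, same names; a few one-line docstrings added where the line had none, and two deprecated
Mathlib names replaced: `iteratedFDeriv_add_apply'` → `fun_iteratedFDeriv_add_apply`, `push_neg` → `push Not`),
only re-homed into an importable module. Landed by ns-tc-p1 g5 (LEAD lineage of 24077) on DIRECTOR-NS #244 (b),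
`--supports stmt-NavierStokesRegularity-24077 --as helper`.

* `SlabJets C₀ A τ` — the S2a OBJECT: every `IsTypeIAncientMild C₀` solution has joint space-time jets
  `‖Dᵏ(uncurry u)(−1,x)‖ ≤ A·k!·τᵏ` at every `(−1, x)`;
* the similarity curve `simCurve y : σ ↦ (−e^{−σ}, e^{−σ/2} y)` and its jets (`norm_iteratedFDeriv_simCurve_zero_le`),
  the time cut-off `timeCut` and the globally smooth cut-off extension (`contDiff_cutExt`, `cutExt_eventuallyEq`),
  the Leibniz estimate `comb_sum_le`;
* `jets_at_zero` (Faà di Bruno along the similarity curve, tree `norm_iteratedFDeriv_comp_le_of_factorial`) and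
  **`profileGevreyBoundMild_of_slabJets`**: `SlabJets C₀ A τ ⇒ ProfileGevreyBoundMild C₀ R (max 1 (2A)) (1/(4(1+τ(1+R))))`.

HONEST FRAMING: a RUNG line on the DSS wall, NEAR-ONE LANE ONLY; it does NOT conclude the crux `TypeIQuantSubcubicExp`
(24077), does not narrow S3 `stub_thinCascadeLiouville`, and proves no summit statement; NS regularity is OPEN.
The line's only `sorry`, S2a `stub_slabJets : ∀ C₀ > 0, ∃ A τ > 0, SlabJets C₀ A τ` (class-uniform analyticity
jets — a Literature-grade re-filing of Lemarié-Rieusset Thm 9.12 / Dong–Zhang Prop 1 with uniform constants), is NOT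
in this file and is keyed to no prover; this file proves only the REDUCTION S2 ⇐ S2a.
-/

noncomputable section

-- the summit-side namespace repeats a component by design (D-0017)
set_option linter.dupNamespace false

namespace Summit.NavierStokesRegularity.NavierStokesRegularity.Cruxes.TypeIQuantSubcubicExp.AnalyticWindow

open MeasureTheory Set Function Filter Topology Metric
open scoped Nat
open Literature.Analysis Literature.Analysis.FluidPDE Literature.Analysis.Calculus
open Summit.NavierStokesRegularity.NavierStokesRegularity.Cruxes.TypeIQuantSubcubicExp.FlatWindow

/-! ### S2a object and the S2b reduction (verbatim from `Lines/analytic_window.lean` v4) -/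

/-- **S2a object (v4): class-uniform real-analyticity jets at time `−1`.**  Every Type-I ancient mild solution of
the class `IsTypeIAncientMild C₀` has, at every point `(−1, x)`, joint space-time jets
`‖Dᵏ(uncurry u)(−1,x)‖ ≤ A·k!·τᵏ` (`A, τ` depending on `C₀` only; product norm on `ℝ × ℝ³`).  This is the
Literature-grade input (Lemarié-Rieusset 2016 Thm 9.12 in its complex-extension form, pp. 261–263: holomorphic
extension of a bounded Oseen-mild solution to `t₀ + Ω_{γ,M₀}`, `M₀ = (8C₂²‖u‖_∞)⁻²`, bound `2‖u(t₀)‖_∞`; Dong–Zhang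
2020 Prop 1 for the time variable; then Cauchy estimates) — the tree's typed versions
(`lemarieRieusset2016_local_analyticity`, `DongZhang2020_timeDerivative_bounds_boundedMild`) are qualitative /
`∃N`-after-`u`, so S2a is ONE re-filing with uniform constants (refuter briefing ns-afl-r1 g9, 15:32:10Z). -/
def SlabJets (C₀ A τ : ℝ) : Prop :=
  ∀ u : ℝ → EuclideanSpace ℝ (Fin 3) → EuclideanSpace ℝ (Fin 3), IsTypeIAncientMild C₀ u →
    ∀ (x : EuclideanSpace ℝ (Fin 3)) (k : ℕ),
      ‖iteratedFDeriv ℝ k (Function.uncurry u) ((-1 : ℝ), x)‖ ≤ A * (k ! : ℝ) * τ ^ k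

/-! #### The similarity curve through a label -/

/-- `σ ↦ (−e^{−σ}, e^{−σ/2} y)`. -/
def simCurve (y : EuclideanSpace ℝ (Fin 3)) : ℝ → ℝ × EuclideanSpace ℝ (Fin 3) :=
  fun σ => (-Real.exp (-σ), Real.exp (-σ / 2) • y)

/-- The similarity curve passes through `(−1, y)` at `σ = 0`. [docstring added at landing] -/
theorem simCurve_zero (y : EuclideanSpace ℝ (Fin 3)) : simCurve y 0 = ((-1 : ℝ), y) := by
  simp [simCurve]

/-- The similarity curve as a sum of two rank-one curves (for the Leibniz/Faà di Bruno bookkeeping). [docstring added at landing] -/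
theorem simCurve_eq (y : EuclideanSpace ℝ (Fin 3)) :
    simCurve y = fun σ =>
      (ContinuousLinearMap.toSpanSingleton ℝ (((1 : ℝ), (0 : EuclideanSpace ℝ (Fin 3))) : ℝ × EuclideanSpace ℝ (Fin 3)))
          (-Real.exp ((-1 : ℝ) * σ)) +
        (ContinuousLinearMap.toSpanSingleton ℝ (((0 : ℝ), y) : ℝ × EuclideanSpace ℝ (Fin 3)))
          (Real.exp ((-1 / 2 : ℝ) * σ)) := by
  funext σ
  simp only [simCurve, ContinuousLinearMap.toSpanSingleton_apply, Prod.smul_mk, smul_eq_mul, mul_one,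
    smul_zero, mul_zero, Prod.mk_add_mk, add_zero, zero_add]
  rw [Prod.mk.injEq]
  constructor
  · ring_nf
  · congr 1; ring_nf

/-- `σ ↦ −e^{−σ}` is smooth. [docstring added at landing] -/
theorem contDiff_neg_exp : ContDiff ℝ (⊤ : ℕ∞) (fun σ : ℝ => -Real.exp ((-1 : ℝ) * σ)) :=
  (Real.contDiff_exp.comp (contDiff_const.mul contDiff_id)).neg

/-- `σ ↦ e^{−σ/2}` is smooth. [docstring added at landing] -/
theorem contDiff_exp_half : ContDiff ℝ (⊤ : ℕ∞) (fun σ : ℝ => Real.exp ((-1 / 2 : ℝ) * σ)) :=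
  Real.contDiff_exp.comp (contDiff_const.mul contDiff_id)

/-- The similarity curve is smooth. [docstring added at landing] -/
theorem contDiff_simCurve (y : EuclideanSpace ℝ (Fin 3)) : ContDiff ℝ (⊤ : ℕ∞) (simCurve y) := by
  rw [simCurve_eq]
  exact ((ContinuousLinearMap.contDiff _).comp contDiff_neg_exp).add
    ((ContinuousLinearMap.contDiff _).comp contDiff_exp_half)

/-- All derivatives of `σ ↦ −e^{−σ}` at `0` have norm `1`. [docstring added at landing] -/
theorem norm_iteratedDeriv_neg_exp (i : ℕ) :
    ‖iteratedDeriv i (fun σ : ℝ => -Real.exp ((-1 : ℝ) * σ)) 0‖ = 1 := by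
  rw [iteratedDeriv_fun_neg, iteratedDeriv_exp_const_mul]
  simp

/-- All derivatives of `σ ↦ e^{−σ/2}` at `0` have norm `≤ 1`. [docstring added at landing] -/
theorem norm_iteratedDeriv_exp_half (i : ℕ) :
    ‖iteratedDeriv i (fun σ : ℝ => Real.exp ((-1 / 2 : ℝ) * σ)) 0‖ ≤ 1 := by
  rw [iteratedDeriv_exp_const_mul]
  simp only [mul_zero, Real.exp_zero, mul_one, norm_pow, Real.norm_eq_abs]
  rw [abs_div, abs_neg, abs_one, abs_two]
  exact pow_le_one₀ (by norm_num) (by norm_num)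

/-- Jets of the similarity curve at `σ = 0`: `‖Dⁱγ_y(0)‖ ≤ 1 + ‖y‖`. -/
theorem norm_iteratedFDeriv_simCurve_zero_le (y : EuclideanSpace ℝ (Fin 3)) (i : ℕ) :
    ‖iteratedFDeriv ℝ i (simCurve y) 0‖ ≤ 1 + ‖y‖ := by
  rw [simCurve_eq]
  set L₁ := ContinuousLinearMap.toSpanSingleton ℝ (((1 : ℝ), (0 : EuclideanSpace ℝ (Fin 3))) : ℝ × EuclideanSpace ℝ (Fin 3))
  set L₂ := ContinuousLinearMap.toSpanSingleton ℝ (((0 : ℝ), y) : ℝ × EuclideanSpace ℝ (Fin 3))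
  have h1 : ContDiff ℝ (⊤ : ℕ∞) (fun σ => L₁ (-Real.exp ((-1 : ℝ) * σ))) := (L₁.contDiff).comp contDiff_neg_exp
  have h2 : ContDiff ℝ (⊤ : ℕ∞) (fun σ => L₂ (Real.exp ((-1 / 2 : ℝ) * σ))) := (L₂.contDiff).comp contDiff_exp_half
  rw [fun_iteratedFDeriv_add_apply (h1.of_le (by exact_mod_cast le_top)).contDiffAt (h2.of_le (by exact_mod_cast le_top)).contDiffAt]
  refine (norm_add_le _ _).trans ?_
  have e1 : iteratedFDeriv ℝ i (fun σ => L₁ (-Real.exp ((-1 : ℝ) * σ))) 0 =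
      L₁.compContinuousMultilinearMap (iteratedFDeriv ℝ i (fun σ : ℝ => -Real.exp ((-1 : ℝ) * σ)) 0) :=
    L₁.iteratedFDeriv_comp_left (contDiff_neg_exp.contDiffAt) (i := i) (by exact_mod_cast le_top)
  have e2 : iteratedFDeriv ℝ i (fun σ => L₂ (Real.exp ((-1 / 2 : ℝ) * σ))) 0 =
      L₂.compContinuousMultilinearMap (iteratedFDeriv ℝ i (fun σ : ℝ => Real.exp ((-1 / 2 : ℝ) * σ)) 0) :=
    L₂.iteratedFDeriv_comp_left (contDiff_exp_half.contDiffAt) (i := i) (by exact_mod_cast le_top)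
  rw [e1, e2]
  have n1 : ‖L₁‖ = 1 := by
    rw [ContinuousLinearMap.norm_toSpanSingleton]; simp [Prod.norm_def]
  have n2 : ‖L₂‖ = ‖y‖ := by
    rw [ContinuousLinearMap.norm_toSpanSingleton]; simp [Prod.norm_def]
  have b1 := L₁.norm_compContinuousMultilinearMap_le (iteratedFDeriv ℝ i (fun σ : ℝ => -Real.exp ((-1 : ℝ) * σ)) 0)
  have b2 := L₂.norm_compContinuousMultilinearMap_le (iteratedFDeriv ℝ i (fun σ : ℝ => Real.exp ((-1 / 2 : ℝ) * σ)) 0)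
  rw [n1, norm_iteratedFDeriv_eq_norm_iteratedDeriv, norm_iteratedDeriv_neg_exp] at b1
  rw [n2, norm_iteratedFDeriv_eq_norm_iteratedDeriv] at b2
  have b2' : ‖L₂.compContinuousMultilinearMap (iteratedFDeriv ℝ i (fun σ : ℝ => Real.exp ((-1 / 2 : ℝ) * σ)) 0)‖ ≤ ‖y‖ :=
    b2.trans (by nlinarith [norm_nonneg y, norm_iteratedDeriv_exp_half i,
      norm_nonneg (iteratedDeriv i (fun σ : ℝ => Real.exp ((-1 / 2 : ℝ) * σ)) 0)])
  linarith

/-! #### A combinatorial estimate -/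

/-- The Leibniz sum against factorial jets is at most `2·A·n!·τ₁ⁿ` for `τ₁ ≥ 2`. [docstring added at landing] -/
theorem comb_sum_le {A τ₁ : ℝ} (hA : 0 ≤ A) (hτ₁ : 2 ≤ τ₁) (n : ℕ) :
    ∑ i ∈ Finset.range (n + 1), (n.choose i : ℝ) * 1 * (A * ((n - i) ! : ℝ) * τ₁ ^ (n - i)) ≤
      2 * A * (n ! : ℝ) * τ₁ ^ n := by
  have hτ0 : 0 ≤ τ₁ := by linarith
  have hterm : ∀ i ∈ Finset.range (n + 1),
      (n.choose i : ℝ) * 1 * (A * ((n - i) ! : ℝ) * τ₁ ^ (n - i)) ≤ A * (n ! : ℝ) * τ₁ ^ n * (1 / 2 : ℝ) ^ i := by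
    intro i hi
    have hin : i ≤ n := Nat.lt_succ_iff.1 (Finset.mem_range.1 hi)
    have hcf : (n.choose i : ℝ) * ((n - i) ! : ℝ) ≤ (n ! : ℝ) := by
      have h := Nat.choose_mul_factorial_mul_factorial hin
      have h' : n.choose i * (n - i)! ≤ n ! := by
        calc n.choose i * (n - i)! ≤ n.choose i * (n - i)! * i ! :=
              Nat.le_mul_of_pos_right _ (Nat.factorial_pos i)
          _ = n ! := by rw [← h]; ring
      exact_mod_cast h'
    have hpow : τ₁ ^ (n - i) ≤ τ₁ ^ n * (1 / 2 : ℝ) ^ i := by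
      rw [one_div, inv_pow, ← div_eq_mul_inv, le_div_iff₀ (by positivity)]
      calc τ₁ ^ (n - i) * 2 ^ i ≤ τ₁ ^ (n - i) * τ₁ ^ i := by gcongr
        _ = τ₁ ^ n := by rw [← pow_add, Nat.sub_add_cancel hin]
    calc (n.choose i : ℝ) * 1 * (A * ((n - i) ! : ℝ) * τ₁ ^ (n - i))
        = A * ((n.choose i : ℝ) * ((n - i) ! : ℝ)) * τ₁ ^ (n - i) := by ring
      _ ≤ A * (n ! : ℝ) * (τ₁ ^ n * (1 / 2 : ℝ) ^ i) := by gcongr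
      _ = A * (n ! : ℝ) * τ₁ ^ n * (1 / 2 : ℝ) ^ i := by ring
  calc ∑ i ∈ Finset.range (n + 1), (n.choose i : ℝ) * 1 * (A * ((n - i) ! : ℝ) * τ₁ ^ (n - i))
      ≤ ∑ i ∈ Finset.range (n + 1), A * (n ! : ℝ) * τ₁ ^ n * (1 / 2 : ℝ) ^ i := Finset.sum_le_sum hterm
    _ = A * (n ! : ℝ) * τ₁ ^ n * ∑ i ∈ Finset.range (n + 1), (1 / 2 : ℝ) ^ i := by rw [Finset.mul_sum]
    _ ≤ A * (n ! : ℝ) * τ₁ ^ n * 2 := by gcongr; exact sum_geometric_two_le _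
    _ = 2 * A * (n ! : ℝ) * τ₁ ^ n := by ring

/-! #### The cut-off extension of `uncurry u` -/

/-- smooth time cut-off: `= 1` for `t ≤ −1/2`, `= 0` for `t ≥ −1/3`. -/
def timeCut (t : ℝ) : ℝ := Real.smoothTransition (-6 * t - 2)

/-- The cut-off equals `1` for `t ≤ −1/2`. [docstring added at landing] -/
theorem timeCut_of_le {t : ℝ} (ht : t ≤ -1 / 2) : timeCut t = 1 :=
  Real.smoothTransition.one_of_one_le (by linarith)

/-- The cut-off vanishes for `t ≥ −1/3`. [docstring added at landing] -/
theorem timeCut_of_ge {t : ℝ} (ht : -1 / 3 ≤ t) : timeCut t = 0 :=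
  Real.smoothTransition.zero_of_nonpos (by linarith)

/-- The cut-off is smooth. [docstring added at landing] -/
theorem contDiff_timeCut : ContDiff ℝ (⊤ : ℕ∞) timeCut :=
  Real.smoothTransition.contDiff.comp ((contDiff_const.mul contDiff_id).sub contDiff_const)

/-- `g(t,x) = χ(t) u(t,x)` is globally smooth when `u` is smooth on the open past. -/
theorem contDiff_cutExt {u : ℝ → EuclideanSpace ℝ (Fin 3) → EuclideanSpace ℝ (Fin 3)}
    (hu : ContDiffOn ℝ (⊤ : ℕ∞) (uncurry u) (Iio 0 ×ˢ univ)) :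
    ContDiff ℝ (⊤ : ℕ∞) (fun z : ℝ × EuclideanSpace ℝ (Fin 3) => timeCut z.1 • uncurry u z) := by
  rw [contDiff_iff_contDiffAt]
  intro z
  by_cases hz : z.1 < 0
  · have h1 : ContDiffAt ℝ (⊤ : ℕ∞) (uncurry u) z :=
      hu.contDiffAt ((isOpen_Iio.prod isOpen_univ).mem_nhds ⟨hz, mem_univ _⟩)
    have h2 : ContDiffAt ℝ (⊤ : ℕ∞) (fun z : ℝ × EuclideanSpace ℝ (Fin 3) => timeCut z.1) z :=
      (contDiff_timeCut.comp contDiff_fst).contDiffAt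
    exact h2.smul h1
  · push Not at hz
    have hev : (fun z : ℝ × EuclideanSpace ℝ (Fin 3) => timeCut z.1 • uncurry u z) =ᶠ[𝓝 z]
        fun _ => (0 : EuclideanSpace ℝ (Fin 3)) := by
      have ho : IsOpen {z' : ℝ × EuclideanSpace ℝ (Fin 3) | -1 / 3 < z'.1} := isOpen_lt continuous_const continuous_fst
      filter_upwards [ho.mem_nhds (show -1 / 3 < z.1 by linarith)] with z' hz'
      rw [timeCut_of_ge (le_of_lt hz'), zero_smul]
    exact contDiffAt_const.congr_of_eventuallyEq hev

/-- Near `(−1, x)` the cut-off extension agrees with `uncurry u`. [docstring added at landing] -/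
theorem cutExt_eventuallyEq {u : ℝ → EuclideanSpace ℝ (Fin 3) → EuclideanSpace ℝ (Fin 3)}
    (x : EuclideanSpace ℝ (Fin 3)) :
    (fun z : ℝ × EuclideanSpace ℝ (Fin 3) => timeCut z.1 • uncurry u z) =ᶠ[𝓝 ((-1 : ℝ), x)] uncurry u := by
  have ho : IsOpen {z' : ℝ × EuclideanSpace ℝ (Fin 3) | z'.1 < -1 / 2} := isOpen_lt continuous_fst continuous_const
  filter_upwards [ho.mem_nhds (show ((-1 : ℝ), x).1 < -1 / 2 by norm_num)] with z' hz'
  rw [timeCut_of_le (le_of_lt hz'), one_smul]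

/-! #### S2b, step 1: jets of the profile line at `σ = 0` -/

/-- **S2b, step 1**: jets of the profile line at `σ = 0` from the slab jets (cut-off extension, Faà di Bruno along the similarity curve, Leibniz with the weight `e^{−σ/2}`). [docstring added at landing] -/
theorem jets_at_zero {C₀ A τ R : ℝ} (hA : 0 ≤ A) (hτ : 0 ≤ τ) (hR : 0 ≤ R) (hJ : SlabJets C₀ A τ)
    {v : ℝ → EuclideanSpace ℝ (Fin 3) → EuclideanSpace ℝ (Fin 3)} (hv : IsTypeIAncientMild C₀ v)
    {y : EuclideanSpace ℝ (Fin 3)} (hy : ‖y‖ ≤ R) (n : ℕ) :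
    ‖iteratedDeriv n (profileLine v y) 0‖ ≤ 2 * A * (n ! : ℝ) * (4 * (1 + τ * (1 + R))) ^ n := by
  set g : ℝ × EuclideanSpace ℝ (Fin 3) → EuclideanSpace ℝ (Fin 3) := fun z => timeCut z.1 • uncurry v z with hgdef
  have hg : ContDiff ℝ (⊤ : ℕ∞) g := contDiff_cutExt hv.contDiffOn
  have hjet : ∀ k, ‖iteratedFDeriv ℝ k g (simCurve y 0)‖ ≤ A * (k ! : ℝ) * τ ^ k := by
    intro k
    rw [simCurve_zero, ((cutExt_eventuallyEq (u := v) y).iteratedFDeriv (𝕜 := ℝ) k).eq_of_nhds]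
    exact hJ v hv y k
  -- composition with the similarity curve
  have hcomp : ∀ m, ‖iteratedFDeriv ℝ m (g ∘ simCurve y) 0‖ ≤ A * (m ! : ℝ) * (4 * (1 + τ * (1 + R))) ^ m := by
    intro m
    have h := norm_iteratedFDeriv_comp_le_of_factorial (contDiff_simCurve y) 0 (B := 1 + R) (σ := 1) (τ := τ)
      (by positivity) zero_le_one hτ m
      (fun i hi _ => by
        rw [one_pow, mul_one]
        calc ‖iteratedFDeriv ℝ i (simCurve y) 0‖ ≤ 1 + ‖y‖ := norm_iteratedFDeriv_simCurve_zero_le y i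
          _ ≤ (1 + R) * 1 := by linarith
          _ ≤ (1 + R) * (i ! : ℝ) := by gcongr; exact_mod_cast Nat.one_le_iff_ne_zero.2 (Nat.factorial_ne_zero i))
      hg A 0 (fun k _ => by simpa using hjet k)
    simpa using h
  -- the weight `e^{−σ/2}` and the local identity with the profile line
  have heq : profileLine v y =ᶠ[𝓝 0] fun σ => Real.exp ((-1 / 2 : ℝ) * σ) • (g ∘ simCurve y) σ := by
    have hlog : (0 : ℝ) < Real.log 2 := Real.log_pos one_lt_two
    filter_upwards [Iio_mem_nhds hlog] with σ hσ
    have hexp : 1 / 2 < Real.exp (-σ) := by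
      have : Real.exp (-Real.log 2) = 1 / 2 := by rw [Real.exp_neg, Real.exp_log two_pos]; norm_num
      rw [← this]; exact Real.exp_lt_exp.2 (by linarith [mem_Iio.1 hσ])
    have hcut : timeCut (-Real.exp (-σ)) = 1 := timeCut_of_le (by linarith)
    simp only [profileLine, lerayOrbit_apply, comp_apply, simCurve, hgdef, uncurry_apply_pair, hcut, one_smul]
    congr 1; ring_nf
  rw [heq.iteratedDeriv_eq n, ← norm_iteratedFDeriv_eq_norm_iteratedDeriv]
  have hφ : ContDiff ℝ (⊤ : ℕ∞) (fun σ : ℝ => Real.exp ((-1 / 2 : ℝ) * σ)) := contDiff_exp_half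
  have hh : ContDiff ℝ (⊤ : ℕ∞) (g ∘ simCurve y) := hg.comp (contDiff_simCurve y)
  refine (norm_iteratedFDeriv_smul_le hφ hh 0 (n := n) (by exact_mod_cast le_top)).trans ?_
  have hτ₁ : 2 ≤ 4 * (1 + τ * (1 + R)) := by nlinarith [mul_nonneg hτ (by linarith : (0:ℝ) ≤ 1 + R)]
  refine le_trans (Finset.sum_le_sum fun i hi => ?_) (comb_sum_le hA hτ₁ n)
  have a1 : ‖iteratedFDeriv ℝ i (fun σ : ℝ => Real.exp ((-1 / 2 : ℝ) * σ)) 0‖ ≤ 1 := by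
    rw [norm_iteratedFDeriv_eq_norm_iteratedDeriv]; exact norm_iteratedDeriv_exp_half i
  have a2 := hcomp (n - i)
  gcongr

/-! #### S2b, step 2: scaling covariance makes the constants uniform in `s` -/

/-- Profile lines of a Type-I ancient mild solution are smooth. [docstring added at landing] -/
theorem contDiff_profileLine_of_mild {C₀ : ℝ} {u : ℝ → EuclideanSpace ℝ (Fin 3) → EuclideanSpace ℝ (Fin 3)}
    (hu : IsTypeIAncientMild C₀ u) (y : EuclideanSpace ℝ (Fin 3)) (n : ℕ) : ContDiff ℝ n (profileLine u y) := by
  have h := (contDiff_uncurry_lerayOrbit hu.contDiffOn).comp (contDiff_id.prodMk contDiff_const : ContDiff ℝ (⊤ : ℕ∞) fun s : ℝ => (s, y))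
  exact h.of_le (by exact_mod_cast le_top)

/-- **S2b PROVED**: slab jets `(A, τ)` at time `−1` give Gevrey-1 profile lines on `‖y‖ ≤ R` with `C₁ = max 1 (2A)`, `θ = 1/(4(1 + τ(1 + R)))`, uniformly in `s` by scaling covariance (`lerayOrbit_nsRescale`, `IsTypeIAncientMild.nsRescale`). [docstring added at landing] -/
theorem profileGevreyBoundMild_of_slabJets {C₀ A τ R : ℝ} (hA : 0 ≤ A) (hτ : 0 ≤ τ) (hR : 0 ≤ R)
    (hJ : SlabJets C₀ A τ) :
    ProfileGevreyBoundMild C₀ R (max 1 (2 * A)) (1 / (4 * (1 + τ * (1 + R)))) := by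
  intro u hu y hy
  refine ⟨fun n => contDiff_profileLine_of_mild hu y n, fun n _ s => ?_⟩
  set c : ℝ := Real.exp (-s / 2) with hcdef
  have hc : 0 < c := Real.exp_pos _
  have hv : IsTypeIAncientMild C₀ (FluidPDE.nsRescale c u) := hu.nsRescale hc
  have hshift : profileLine u y = fun σ => profileLine (FluidPDE.nsRescale c u) y (σ - s) := by
    funext σ
    simp only [profileLine]
    rw [lerayOrbit_nsRescale hc, hcdef, Real.log_exp]
    congr 1; ring
  rw [hshift, iteratedDeriv_comp_sub_const]
  simp only [sub_self]
  have hj := jets_at_zero hA hτ hR hJ hv hy n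
  have hτ₁ : 0 < 4 * (1 + τ * (1 + R)) := by nlinarith [mul_nonneg hτ (by linarith : (0:ℝ) ≤ 1 + R)]
  rw [one_div, inv_pow, div_eq_mul_inv, inv_inv]
  calc ‖iteratedDeriv n (profileLine (FluidPDE.nsRescale c u) y) 0‖
      ≤ 2 * A * (n ! : ℝ) * (4 * (1 + τ * (1 + R))) ^ n := hj
    _ ≤ max 1 (2 * A) * (n ! : ℝ) * (4 * (1 + τ * (1 + R))) ^ n := by gcongr; exact le_max_right _ _

end Summit.NavierStokesRegularity.NavierStokesRegularity.Cruxes.TypeIQuantSubcubicExp.AnalyticWindow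

end
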